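import Summits.MatrixMultiplication.MatrixMultiplication.Theorems.SoloInformedValFamilyBudget
import Summits.MatrixMultiplication.MatrixMultiplication.Theorems.SoloInformedValHalfVolume

/-!
# The common-period budget for families of complete blocks

Setting of `SoloInformedValFamilyCriterion` / `SoloInformedValFamilyBudget` (finite abelian group, identity
potentials, a finite family of complete blocks `X_c × Y_c × Z_c`, accidental-freeness, the family criterion
`M_c ⊥ U_c ⊥ V_c` and its `Y ↔ Z` mirror).

Let `R ⊆ G` be a finite set closed under subtraction (a finite subgroup) which is a COMMON PERIOD of all the
`JK`-difference sets: `D_c + R ⊆ D_c` for every block `c`, `D_c = Y_c − Z_c`.  Then for every block `a` and every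
other block `b ≠ a` of an accidental-free family with pairwise disjoint, nonempty `Y`- and `Z`-classes
(`NoAccidental.common_period_budget`):

  `|X_a||Y_a||Z_a| + |X_a|·|R| + Σ_{c ≠ a} |X_c|·|R| ≤ |G|`.

The three disjoint sets are the mirror `M`-set `X_a + Z_a − Y_a` (which is `R`-saturated), the `R`-saturated
translate `X_a + (z_b − y_b) + R ⊆ Ũ_a`, and `Ṽ_a + R`, which contains the pairwise disjoint sets
`X_c + (z_a − y_c) + R` (`c ≠ a`; disjointness is the criterion `U_c ⊥ V_c`), each of size `|X_c||R|` because the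
rows of `X_c` are pairwise incongruent modulo `R ⊆ D_c − D_c` (TPP).  `AddTPP.card_sumSet_translate` is that count.

If moreover every `D_c` lies in a single `R`-coset (so `D_c` is exactly a coset and `|Y_c||Z_c| ≤ |R|`), this gives
(`NoAccidental.two_mul_volume_add_sum_volume_le`, `NoAccidental.volume_add_total_volume_le`)

  `2|X_a||Y_a||Z_a| + Σ_{c ≠ a} |X_c||Y_c||Z_c| ≤ |G|`,  i.e.  `T + |X_a||Y_a||Z_a| ≤ |G|`  (`T` = total volume),

so every such family satisfies `T ≤ |G|` and hence `T³ ≤ |G|²·I·J·K` (as `T ≤ I·J·K` trivially): the bound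
`T³ ≤ |G|² IJK` holds for all accidental-free unions of complete blocks whose `JK`-difference sets are cosets of one
common subgroup — in particular for every 'pure subspace' design with a common period space, whatever the number of
blocks and the row pattern.
-/

namespace Summit.MatrixMultiplication.MatrixMultiplication.Theorems.SoloVal

open Finset

section CommonPeriod

variable {G : Type*} [AddCommGroup G] [DecidableEq G]

omit [DecidableEq G] in
/-- A nonempty finite set closed under subtraction contains `0`. -/
theorem subClosed_zero_mem {R : Finset G} (hR : ∀ r ∈ R, ∀ s ∈ R, r - s ∈ R) (hne : R.Nonempty) :
    (0 : G) ∈ R := by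
  obtain ⟨r, hr⟩ := hne
  have h := hR r hr r hr
  rwa [sub_self] at h

omit [DecidableEq G] in
/-- A finite set closed under subtraction is closed under negation. -/
theorem subClosed_neg_mem {R : Finset G} (hR : ∀ r ∈ R, ∀ s ∈ R, r - s ∈ R) {r : G} (hr : r ∈ R) :
    -r ∈ R := by
  have h := hR 0 (subClosed_zero_mem hR ⟨r, hr⟩) r hr
  rwa [zero_sub] at h

/-- `d ∈ B − A` iff `−d ∈ A − B`. -/
theorem mem_diffSet_swap {A B : Finset G} {d : G} : d ∈ diffSet B A ↔ -d ∈ diffSet A B := by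
  rw [mem_diffSet, mem_diffSet]
  constructor
  · rintro ⟨b, hb, a, ha, rfl⟩
    exact ⟨a, ha, b, hb, by abel⟩
  · rintro ⟨a, ha, b, hb, h⟩
    refine ⟨b, hb, a, ha, ?_⟩
    calc b - a = -(a - b) := (neg_sub a b).symm
      _ = d := by rw [h, neg_neg]

/-- If `Y − Z` is `R`-saturated (`R` closed under subtraction) then so is `Z − Y`. -/
theorem diffSet_swap_sat {Y₀ Z₀ R : Finset G} (hR : ∀ r ∈ R, ∀ s ∈ R, r - s ∈ R)
    (hsat : ∀ d ∈ diffSet Y₀ Z₀, ∀ r ∈ R, d + r ∈ diffSet Y₀ Z₀) :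
    ∀ d ∈ diffSet Z₀ Y₀, ∀ r ∈ R, d + r ∈ diffSet Z₀ Y₀ := by
  intro d hd r hr
  rw [mem_diffSet_swap] at hd ⊢
  have h := hsat (-d) hd (-r) (subClosed_neg_mem hR hr)
  have e : -(d + r) = -d + -r := by abel
  rw [e]
  exact h

/-- UNIQUE REPRESENTATION MODULO A PERIOD.  If `(X, Y, Z)` has the TPP and `R` is a period of the nonempty
difference set `Y − Z` (`(Y − Z) + R ⊆ Y − Z`), then the rows of `X` are pairwise incongruent modulo `R`, so every
translate `X + (g + R)` has exactly `|X|·|R|` elements. -/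
theorem AddTPP.card_sumSet_translate {X₀ Y₀ Z₀ R : Finset G} (h : AddTPP X₀ Y₀ Z₀)
    (hsat : ∀ d ∈ diffSet Y₀ Z₀, ∀ r ∈ R, d + r ∈ diffSet Y₀ Z₀) (hD : (diffSet Y₀ Z₀).Nonempty) (g : G) :
    (sumSet X₀ (R.image fun r => g + r)).card = X₀.card * R.card := by
  obtain ⟨d₀, hd₀⟩ := hD
  have hinj : Set.InjOn (fun p : G × G => p.1 + (g + p.2)) ↑(X₀ ×ˢ R) := by
    rintro ⟨x, r⟩ hm ⟨x', r'⟩ hm' heq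
    simp only [Finset.coe_product, Set.mem_prod, Finset.mem_coe] at hm hm'
    have heq' : x + (g + r) = x' + (g + r') := heq
    obtain ⟨y₂, hy₂, z₂, hz₂, h₂⟩ := mem_diffSet.mp (hsat d₀ hd₀ r hm.2)
    obtain ⟨y₁, hy₁, z₁, hz₁, h₁⟩ := mem_diffSet.mp (hsat d₀ hd₀ r' hm'.2)
    have h0 : (x - y₁) + (y₂ - z₂) + (z₁ - x') = 0 := by
      have e : (x - y₁) + (y₂ - z₂) + (z₁ - x') = (x + (y₂ - z₂)) - (x' + (y₁ - z₁)) := by abel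
      rw [e, h₂, h₁]
      have e2 : x + (d₀ + r) - (x' + (d₀ + r')) = (x + (g + r)) - (x' + (g + r')) := by abel
      rw [e2, heq', sub_self]
    obtain ⟨hx, -, -⟩ := h hm.1 hm'.1 hy₁ hy₂ hz₂ hz₁ h0
    subst hx
    have hr : r = r' := add_left_cancel (add_left_cancel heq')
    rw [hr]
  have hset : sumSet X₀ (R.image fun r => g + r) =
      (X₀ ×ˢ R).image (fun p : G × G => p.1 + (g + p.2)) := by
    ext v
    rw [mem_sumSet, Finset.mem_image]
    constructor
    · rintro ⟨x, hx, e, he, rfl⟩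
      obtain ⟨r, hr, rfl⟩ := Finset.mem_image.mp he
      exact ⟨(x, r), Finset.mem_product.mpr ⟨hx, hr⟩, rfl⟩
    · rintro ⟨⟨x, r⟩, hm, rfl⟩
      rw [Finset.mem_product] at hm
      exact ⟨x, hm.1, g + r, Finset.mem_image.mpr ⟨r, hm.2, rfl⟩, rfl⟩
  rw [hset, Finset.card_image_of_injOn hinj, Finset.card_product]

variable {ι : Type*} [DecidableEq ι]
variable {T : Finset ι} {X Y Z : ι → Finset G} {a b : ι}

/-- THE COMMON-PERIOD BUDGET (criterion form, with chosen base points `y_c ∈ Y_c`, `z_c ∈ Z_c`).  Under the family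
criterion at every block and the mirror criterion at `a`, if `R` (closed under subtraction) is a common period of
all `JK`-difference sets, then `|X_a||Y_a||Z_a| + |X_a||R| + Σ_{c ≠ a} |X_c||R| ≤ |G|` for every other block
`b ≠ a` of the family. -/
theorem common_period_budget_pointed [Fintype G]
    (hcrit : ∀ c ∈ T, FamilyCriterionAt T X Y Z c) (hmir : FamilyCriterionAt T X Z Y a)
    {R : Finset G} (hR : ∀ r ∈ R, ∀ s ∈ R, r - s ∈ R)
    (hsat : ∀ c ∈ T, ∀ d ∈ diffSet (Y c) (Z c), ∀ r ∈ R, d + r ∈ diffSet (Y c) (Z c))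
    {y z : ι → G} (hy : ∀ c ∈ T, y c ∈ Y c) (hz : ∀ c ∈ T, z c ∈ Z c)
    (ha : a ∈ T) (hb : b ∈ T) (hba : b ≠ a) :
    (X a).card * (Y a).card * (Z a).card + (X a).card * R.card +
        ∑ c ∈ T.erase a, (X c).card * R.card ≤ Fintype.card G := by
  have hDne : ∀ c ∈ T, (diffSet (Y c) (Z c)).Nonempty := fun c hc =>
    ⟨y c - z c, mem_diffSet.mpr ⟨y c, hy c hc, z c, hz c hc, rfl⟩⟩
  obtain ⟨htpp', hMU, hMV, hUV⟩ := hmir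
  -- the three sets
  set S₁ := mixedImage (X a) (Z a) (Y a) with hS₁
  set S₂ := sumSet (X a) (R.image fun r => (z b - y b) + r) with hS₂
  set S₃ := sumSet (crossV T X Z Y a) R with hS₃
  have c₁ : S₁.card = (X a).card * (Y a).card * (Z a).card := by
    rw [hS₁, htpp'.card_mixedImage]; ring
  have c₂ : S₂.card = (X a).card * R.card :=
    (hcrit a ha).1.card_sumSet_translate (hsat a ha) (hDne a ha) _
  -- `S₂ ⊆ Ũ_a`
  have hS₂U : S₂ ⊆ crossU T X Z Y a := by
    intro g hg
    obtain ⟨x, hx, e, he, rfl⟩ := mem_sumSet.mp hg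
    obtain ⟨r, hr, rfl⟩ := Finset.mem_image.mp he
    unfold crossU
    refine mem_sumSet.mpr ⟨x, hx, (z b - y b) + r,
      Finset.mem_biUnion.mpr ⟨b, Finset.mem_erase.mpr ⟨hba, hb⟩, ?_⟩, rfl⟩
    rw [mem_diffSet_swap]
    have e : -((z b - y b) + r) = (y b - z b) + -r := by abel
    rw [e]
    exact hsat b hb _ (mem_diffSet.mpr ⟨y b, hy b hb, z b, hz b hb, rfl⟩) _ (subClosed_neg_mem hR hr)
  -- `S₃ ⊇ ⋃_{c ≠ a} (X_c + (z_a − y_c) + R)`, a disjoint union of sets of size `|X_c||R|`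
  have c₃ : ∑ c ∈ T.erase a, (X c).card * R.card ≤ S₃.card := by
    have hdisj : ((T.erase a : Finset ι) : Set ι).PairwiseDisjoint
        fun c => sumSet (X c) (R.image fun r => (z a - y c) + r) := by
      intro c hc c' hc' hcc'
      have hcT : c ∈ T := Finset.mem_of_mem_erase (Finset.mem_coe.mp hc)
      have hc'T : c' ∈ T := Finset.mem_of_mem_erase (Finset.mem_coe.mp hc')
      obtain ⟨-, -, -, hUVc⟩ := hcrit c hcT
      change Disjoint (sumSet (X c) (R.image fun r => (z a - y c) + r))
        (sumSet (X c') (R.image fun r => (z a - y c') + r))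
      rw [Finset.disjoint_left]
      intro g hg hg'
      obtain ⟨x, hx, e, he, hge⟩ := mem_sumSet.mp hg
      obtain ⟨r₁, hr₁, rfl⟩ := Finset.mem_image.mp he
      obtain ⟨x', hx', e', he', hge'⟩ := mem_sumSet.mp hg'
      obtain ⟨r₂, hr₂, rfl⟩ := Finset.mem_image.mp he'
      have h3 : x + ((z a - y c) + r₁) = x' + ((z a - y c') + r₂) := by rw [hge, hge']
      have hw : x + ((y c' - z c') + (r₁ - r₂)) = y c + (x' - z c') := by
        calc x + ((y c' - z c') + (r₁ - r₂))
            = (x + ((z a - y c) + r₁)) + (y c + y c' - z c' - z a - r₂) := by abel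
          _ = (x' + ((z a - y c') + r₂)) + (y c + y c' - z c' - z a - r₂) := by rw [h3]
          _ = y c + (x' - z c') := by abel
      have hU : x + ((y c' - z c') + (r₁ - r₂)) ∈ crossU T X Y Z c := by
        unfold crossU
        exact mem_sumSet.mpr ⟨x, hx, _, Finset.mem_biUnion.mpr ⟨c', Finset.mem_erase.mpr ⟨hcc'.symm, hc'T⟩,
          hsat c' hc'T _ (mem_diffSet.mpr ⟨y c', hy c' hc'T, z c', hz c' hc'T, rfl⟩) _ (hR r₁ hr₁ r₂ hr₂)⟩,
          rfl⟩
      have hV : x + ((y c' - z c') + (r₁ - r₂)) ∈ crossV T X Y Z c := by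
        rw [hw]
        exact mem_crossV.mpr ⟨y c, hy c hcT, c', Finset.mem_erase.mpr ⟨hcc'.symm, hc'T⟩, x', hx',
          z c', hz c' hc'T, rfl⟩
      exact Finset.disjoint_left.mp hUVc hU hV
    have hsub : ((T.erase a).biUnion fun c => sumSet (X c) (R.image fun r => (z a - y c) + r)) ⊆ S₃ := by
      intro g hg
      obtain ⟨c, hc, hgc⟩ := Finset.mem_biUnion.mp hg
      have hcT : c ∈ T := Finset.mem_of_mem_erase hc
      obtain ⟨x, hx, e, he, rfl⟩ := mem_sumSet.mp hgc
      obtain ⟨r, hr, rfl⟩ := Finset.mem_image.mp he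
      rw [hS₃]
      refine mem_sumSet.mpr ⟨z a + (x - y c), ?_, r, hr, by abel⟩
      exact mem_crossV.mpr ⟨z a, hz a ha, c, hc, x, hx, y c, hy c hcT, rfl⟩
    calc ∑ c ∈ T.erase a, (X c).card * R.card
        = ∑ c ∈ T.erase a, (sumSet (X c) (R.image fun r => (z a - y c) + r)).card := by
          refine Finset.sum_congr rfl fun c hc => ?_
          rw [(hcrit c (Finset.mem_of_mem_erase hc)).1.card_sumSet_translate
            (hsat c (Finset.mem_of_mem_erase hc)) (hDne c (Finset.mem_of_mem_erase hc))]
      _ = ((T.erase a).biUnion fun c => sumSet (X c) (R.image fun r => (z a - y c) + r)).card :=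
          (Finset.card_biUnion hdisj).symm
      _ ≤ S₃.card := Finset.card_le_card hsub
  -- `S₁` and `S₂` are `R`-saturated
  have hS₁sat : ∀ g ∈ S₁, ∀ r ∈ R, g - r ∈ S₁ := by
    intro g hg r hr
    rw [hS₁, mixedImage_eq_sumSet_diffSet] at hg ⊢
    obtain ⟨x, hx, d, hd, rfl⟩ := mem_sumSet.mp hg
    refine mem_sumSet.mpr ⟨x, hx, d + -r, ?_, by abel⟩
    exact diffSet_swap_sat hR (hsat a ha) d hd (-r) (subClosed_neg_mem hR hr)
  have hS₂sat : ∀ g ∈ S₂, ∀ r ∈ R, g - r ∈ S₂ := by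
    intro g hg r hr
    obtain ⟨x, hx, e, he, rfl⟩ := mem_sumSet.mp hg
    obtain ⟨r', hr', rfl⟩ := Finset.mem_image.mp he
    exact mem_sumSet.mpr ⟨x, hx, (z b - y b) + (r' - r),
      Finset.mem_image.mpr ⟨r' - r, hR r' hr' r hr, rfl⟩, by abel⟩
  -- pairwise disjointness
  have d₁₂ : Disjoint S₁ S₂ := Finset.disjoint_of_subset_right hS₂U hMU
  have d₁₃ : Disjoint S₁ S₃ := by
    rw [Finset.disjoint_left]
    intro g hg hg'
    obtain ⟨v, hv, r, hr, rfl⟩ := mem_sumSet.mp hg'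
    have hv' : v ∈ S₁ := by
      have h := hS₁sat _ hg r hr
      rwa [add_sub_cancel_right] at h
    exact Finset.disjoint_left.mp hMV hv' hv
  have d₂₃ : Disjoint S₂ S₃ := by
    rw [Finset.disjoint_left]
    intro g hg hg'
    obtain ⟨v, hv, r, hr, rfl⟩ := mem_sumSet.mp hg'
    have hv' : v ∈ S₂ := by
      have h := hS₂sat _ hg r hr
      rwa [add_sub_cancel_right] at h
    exact Finset.disjoint_left.mp hUV (hS₂U hv') hv
  have hunion : (S₁ ∪ S₂ ∪ S₃).card = S₁.card + S₂.card + S₃.card := by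
    rw [Finset.card_union_of_disjoint (Finset.disjoint_union_left.mpr ⟨d₁₃, d₂₃⟩),
      Finset.card_union_of_disjoint d₁₂]
  calc (X a).card * (Y a).card * (Z a).card + (X a).card * R.card + ∑ c ∈ T.erase a, (X c).card * R.card
      ≤ S₁.card + S₂.card + S₃.card := by rw [c₁, c₂]; exact Nat.add_le_add_left c₃ _
    _ = (S₁ ∪ S₂ ∪ S₃).card := hunion.symm
    _ ≤ Fintype.card G := Finset.card_le_univ _

/-- THE COMMON-PERIOD BUDGET.  In an accidental-free family of complete blocks with pairwise disjoint, nonempty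
`Y`- and `Z`-classes, if `R` (a finite set closed under subtraction) is a common period of every `JK`-difference
set `Y_c − Z_c`, then `|X_a||Y_a||Z_a| + |X_a||R| + Σ_{c ≠ a} |X_c||R| ≤ |G|` whenever the family has a second
block `b ≠ a`. -/
theorem NoAccidental.common_period_budget [Fintype G]
    (hY : ∀ a ∈ T, ∀ b ∈ T, a ≠ b → Disjoint (Y a) (Y b))
    (hZ : ∀ a ∈ T, ∀ b ∈ T, a ≠ b → Disjoint (Z a) (Z b))
    (hN : NoAccidental (id : G → G) id id (famPairs T X Y) (famPairs T Y Z) (famPairs T Z X))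
    {R : Finset G} (hR : ∀ r ∈ R, ∀ s ∈ R, r - s ∈ R)
    (hsat : ∀ c ∈ T, ∀ d ∈ diffSet (Y c) (Z c), ∀ r ∈ R, d + r ∈ diffSet (Y c) (Z c))
    (hYne : ∀ c ∈ T, (Y c).Nonempty) (hZne : ∀ c ∈ T, (Z c).Nonempty)
    (ha : a ∈ T) (hb : b ∈ T) (hba : b ≠ a) :
    (X a).card * (Y a).card * (Z a).card + (X a).card * R.card +
        ∑ c ∈ T.erase a, (X c).card * R.card ≤ Fintype.card G := by
  haveI : Nonempty G := ⟨0⟩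
  choose! y hy using hYne
  choose! z hz using hZne
  exact common_period_budget_pointed (fun c hc => familyCriterion_of_noAccidental hY hZ hN hc)
    (familyCriterion_of_noAccidental (X := X) (Y := Z) (Z := Y) hZ hY (NoAccidental.swapYZ hN) ha)
    hR hsat hy hz ha hb hba

/-- COMMON COSETS.  If every `JK`-difference set `Y_c − Z_c` is a coset of one common finite subgroup `R`
(`R`-saturated and contained in a single `R`-coset), then `2|X_a||Y_a||Z_a| + Σ_{c ≠ a} |X_c||Y_c||Z_c| ≤ |G|`
for every block `a` of an accidental-free family (pairwise disjoint nonempty `Y`/`Z`-classes, nonempty row classes)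
with a second block `b ≠ a`. -/
theorem NoAccidental.two_mul_volume_add_sum_volume_le [Fintype G]
    (hY : ∀ a ∈ T, ∀ b ∈ T, a ≠ b → Disjoint (Y a) (Y b))
    (hZ : ∀ a ∈ T, ∀ b ∈ T, a ≠ b → Disjoint (Z a) (Z b))
    (hN : NoAccidental (id : G → G) id id (famPairs T X Y) (famPairs T Y Z) (famPairs T Z X))
    {R : Finset G} (hR : ∀ r ∈ R, ∀ s ∈ R, r - s ∈ R)
    (hsat : ∀ c ∈ T, ∀ d ∈ diffSet (Y c) (Z c), ∀ r ∈ R, d + r ∈ diffSet (Y c) (Z c))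
    (hone : ∀ c ∈ T, ∀ d ∈ diffSet (Y c) (Z c), ∀ d' ∈ diffSet (Y c) (Z c), d - d' ∈ R)
    (hXne : ∀ c ∈ T, (X c).Nonempty) (hYne : ∀ c ∈ T, (Y c).Nonempty) (hZne : ∀ c ∈ T, (Z c).Nonempty)
    (ha : a ∈ T) (hb : b ∈ T) (hba : b ≠ a) :
    2 * ((X a).card * (Y a).card * (Z a).card) +
        ∑ c ∈ T.erase a, (X c).card * (Y c).card * (Z c).card ≤ Fintype.card G := by
  have hvol : ∀ c ∈ T, (Y c).card * (Z c).card ≤ R.card := by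
    intro c hc
    obtain ⟨yc, hyc⟩ := hYne c hc
    obtain ⟨zc, hzc⟩ := hZne c hc
    have hd₀ : yc - zc ∈ diffSet (Y c) (Z c) := mem_diffSet.mpr ⟨yc, hyc, zc, hzc, rfl⟩
    rw [← (familyCriterion_of_noAccidental hY hZ hN hc).1.card_diffSet_YZ_eq (hXne c hc)]
    calc (diffSet (Y c) (Z c)).card ≤ (R.image fun r => (yc - zc) + r).card := by
          apply Finset.card_le_card
          intro d hd
          exact Finset.mem_image.mpr ⟨d - (yc - zc), hone c hc d hd _ hd₀, by abel⟩
      _ ≤ R.card := Finset.card_image_le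
  have h := NoAccidental.common_period_budget hY hZ hN hR hsat hYne hZne ha hb hba
  have e1 : (X a).card * (Y a).card * (Z a).card ≤ (X a).card * R.card := by
    rw [mul_assoc]; exact Nat.mul_le_mul_left _ (hvol a ha)
  have e2 : ∑ c ∈ T.erase a, (X c).card * (Y c).card * (Z c).card ≤
      ∑ c ∈ T.erase a, (X c).card * R.card := by
    apply Finset.sum_le_sum
    intro c hc
    rw [mul_assoc]; exact Nat.mul_le_mul_left _ (hvol c (Finset.mem_of_mem_erase hc))
  linarith

/-- COMMON COSETS, total form: `T + |X_a||Y_a||Z_a| ≤ |G|` where `T = Σ_c |X_c||Y_c||Z_c|` is the total volume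
(the number of triangles) — so `T ≤ |G|`, and therefore `T³ ≤ |G|²·I·J·K`, for every accidental-free union of at
least two complete blocks whose `JK`-difference sets are cosets of a common subgroup. -/
theorem NoAccidental.volume_add_total_volume_le [Fintype G]
    (hY : ∀ a ∈ T, ∀ b ∈ T, a ≠ b → Disjoint (Y a) (Y b))
    (hZ : ∀ a ∈ T, ∀ b ∈ T, a ≠ b → Disjoint (Z a) (Z b))
    (hN : NoAccidental (id : G → G) id id (famPairs T X Y) (famPairs T Y Z) (famPairs T Z X))
    {R : Finset G} (hR : ∀ r ∈ R, ∀ s ∈ R, r - s ∈ R)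
    (hsat : ∀ c ∈ T, ∀ d ∈ diffSet (Y c) (Z c), ∀ r ∈ R, d + r ∈ diffSet (Y c) (Z c))
    (hone : ∀ c ∈ T, ∀ d ∈ diffSet (Y c) (Z c), ∀ d' ∈ diffSet (Y c) (Z c), d - d' ∈ R)
    (hXne : ∀ c ∈ T, (X c).Nonempty) (hYne : ∀ c ∈ T, (Y c).Nonempty) (hZne : ∀ c ∈ T, (Z c).Nonempty)
    (ha : a ∈ T) (hb : b ∈ T) (hba : b ≠ a) :
    (X a).card * (Y a).card * (Z a).card +
        ∑ c ∈ T, (X c).card * (Y c).card * (Z c).card ≤ Fintype.card G := by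
  have h := NoAccidental.two_mul_volume_add_sum_volume_le hY hZ hN hR hsat hone hXne hYne hZne ha hb hba
  rw [← Finset.add_sum_erase T (fun c => (X c).card * (Y c).card * (Z c).card) ha]
  linarith

end CommonPeriod

end Summit.MatrixMultiplication.MatrixMultiplication.Theorems.SoloVal
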